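import Mathlib.Tactic.IntervalCases
import Summits.QuantumAdvantage.QuantumAdvantage.Theorems.CubicForrelationNearExactIsExactCubicFormSymplectic
import Summits.QuantumAdvantage.QuantumAdvantage.Theorems.CubicForrelationNearExactIsExactCubicFormRank
import Summits.QuantumAdvantage.QuantumAdvantage.Theorems.CubicForrelationNearExactIsExactCubicFormDicksonExact

/-!
# Crux `CubicForrelation.NearExactIsExact` (stmt-QuantumAdvantage-14043) — the TWO HALVES of a cell: ranks and weights (cell lemma L2, core)

Certificate seat `b2b-cforr-cert` (gen 41).  HONEST FRAMING: kernel-checked assembly (standard axioms) of the generic tools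
…CubicFormSymplectic (`tcs_frame_exists`), …CubicFormRadical/…CubicFormRank (`tce_radical_card`, `tce_rank_subadd`) and
…CubicFormDicksonExact (`tce_dickson_exact`) into the core of cell lemma L2 of the light-cell analysis of `E1280-even`
(HOME/b2b-cforr-cert-g39/E1280-HANDPROOFS.md App. A.4): for a cell `f` on `1 + 8` bits with cubic form `s₀ ∧ ω`, the halves
`f₀ = f|_{s₀=0}`, `f₁ = f|_{s₀=1}` are quadratics on `𝔽₂⁸` whose alternating forms `β`, `β ⊕ ω` have ranks `2h₀, 2h₁` with
`h₀ + h₁ ≥ rank ω / 2`, and Dickson's theorem bounds `#f = #f₀ + #f₁` from below; for `rank ω ≥ 6` and `#f < 160` this forces `β = 0` or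
`β = ω`.  The statements take the two halves and their (base-point free) forms abstractly.  Nothing about `θ₁₂`; NOT summit progress.

* `tcl_halves_rank`: maximal frames for `B₀`, `B₁` with `μ ≤ h₀ + h₁`, `2hᵢ ≤ n`, and the exact Dickson trichotomies.
* `tcl_halves_eight`: on 8 bits, `μ ≥ 3` and `#f₀ + #f₁ < 160` ⇒ `B₀ ≡ 0` or `B₁ ≡ 0`.

References: L. E. Dickson (1901); F. J. MacWilliams, N. J. A. Sloane (1977) Ch. 15 §2.  Axioms: the standard three.
-/

set_option linter.dupNamespace false -- D-0017: single-problem summit ⇒ `QuantumAdvantage.QuantumAdvantage` by design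

namespace Summit.QuantumAdvantage.QuantumAdvantage.Theorems.CubicForrelation.NearExactIsExact

open Finset
open Literature.Computability.QuantumComplexity.BuzetChailloux (bxor zeroVec bxor_comm bxor_self bxor_zeroVec zeroVec_bxor
  bxor_bxor_cancel_left)

/-- **Ranks of the two halves.**  Let `f₀, f₁ : 𝔽₂ⁿ → Bool` have base-point free second differences `B₀, B₁` (degree `≤ 2`), and let
`ω = B₀ ⊕ B₁` have a maximal frame of size `μ`.  Then `B₀`, `B₁` have maximal symplectic frames, of sizes `h₀, h₁` with
`μ ≤ h₀ + h₁`, `2hᵢ ≤ n`, and the weights of `f₀, f₁` obey Dickson's theorem with these `hᵢ`.  (The two halves `f|_{s₀=0}`, `f|_{s₀=1}`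
of a cell with cubic form `s₀ ∧ ω` are of this kind: E1280-HANDPROOFS App. A.4, cell lemma L2.) [this work; cite: MacWilliamsSloane1977, Ch. 15 §2] -/
theorem tcl_halves_rank {n : ℕ} (f₀ f₁ : (Fin n → Bool) → Bool) (B₀ B₁ : (Fin n → Bool) → (Fin n → Bool) → Bool)
    (hB₀ : ∀ v w x, ((f₀ x ^^ f₀ (bxor x w)) ^^ (f₀ (bxor x v) ^^ f₀ (bxor (bxor x v) w))) = B₀ v w)
    (hB₁ : ∀ v w x, ((f₁ x ^^ f₁ (bxor x w)) ^^ (f₁ (bxor x v) ^^ f₁ (bxor (bxor x v) w))) = B₁ v w)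
    (μ : ℕ) (bω cω : Fin μ → (Fin n → Bool))
    (hω1 : ∀ i, (B₀ (bω i) (cω i) ^^ B₁ (bω i) (cω i)) = true)
    (hω2 : ∀ i j, i ≠ j → (B₀ (bω i) (cω j) ^^ B₁ (bω i) (cω j)) = false)
    (hω3 : ∀ i j, (B₀ (bω i) (bω j) ^^ B₁ (bω i) (bω j)) = false)
    (hωmax : ∀ x y, (∀ i, (B₀ x (bω i) ^^ B₁ x (bω i)) = false) → (∀ i, (B₀ x (cω i) ^^ B₁ x (cω i)) = false) →
      (∀ i, (B₀ y (bω i) ^^ B₁ y (bω i)) = false) → (∀ i, (B₀ y (cω i) ^^ B₁ y (cω i)) = false) → (B₀ x y ^^ B₁ x y) = false) :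
    ∃ (h₀ h₁ : ℕ) (b₀ c₀ : Fin h₀ → (Fin n → Bool)) (b₁ c₁ : Fin h₁ → (Fin n → Bool)),
      ((∀ i, B₀ (b₀ i) (c₀ i) = true) ∧ (∀ i j, i ≠ j → B₀ (b₀ i) (c₀ j) = false) ∧
        (∀ i j, B₀ (b₀ i) (b₀ j) = false) ∧ (∀ i j, B₀ (c₀ i) (c₀ j) = false) ∧
        (∀ x y, (∀ i, B₀ x (b₀ i) = false) → (∀ i, B₀ x (c₀ i) = false) → (∀ i, B₀ y (b₀ i) = false) →
          (∀ i, B₀ y (c₀ i) = false) → B₀ x y = false)) ∧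
      ((∀ i, B₁ (b₁ i) (c₁ i) = true) ∧ (∀ i j, i ≠ j → B₁ (b₁ i) (c₁ j) = false) ∧
        (∀ i j, B₁ (b₁ i) (b₁ j) = false) ∧ (∀ i j, B₁ (c₁ i) (c₁ j) = false) ∧
        (∀ x y, (∀ i, B₁ x (b₁ i) = false) → (∀ i, B₁ x (c₁ i) = false) → (∀ i, B₁ y (b₁ i) = false) →
          (∀ i, B₁ y (c₁ i) = false) → B₁ x y = false)) ∧
      μ ≤ h₀ + h₁ ∧ 2 * h₀ ≤ n ∧ 2 * h₁ ≤ n ∧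
      (2 * #(univ.filter fun x : Fin n → Bool => f₀ x = true) + 2 ^ (n - h₀) = 2 ^ n ∨
        2 * #(univ.filter fun x : Fin n → Bool => f₀ x = true) = 2 ^ n ∨
        2 * #(univ.filter fun x : Fin n → Bool => f₀ x = true) = 2 ^ n + 2 ^ (n - h₀)) ∧
      (2 * #(univ.filter fun x : Fin n → Bool => f₁ x = true) + 2 ^ (n - h₁) = 2 ^ n ∨
        2 * #(univ.filter fun x : Fin n → Bool => f₁ x = true) = 2 ^ n ∨
        2 * #(univ.filter fun x : Fin n → Bool => f₁ x = true) = 2 ^ n + 2 ^ (n - h₁)) := by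
  classical
  -- symmetric, alternating, additive
  have hsa : ∀ (f : (Fin n → Bool) → Bool) (B : (Fin n → Bool) → (Fin n → Bool) → Bool),
      (∀ v w x, ((f x ^^ f (bxor x w)) ^^ (f (bxor x v) ^^ f (bxor (bxor x v) w))) = B v w) →
      (∀ v w, B v w = B w v) ∧ (∀ v, B v v = false) ∧ (∀ u v w, B (bxor u v) w = (B u w ^^ B v w)) := by
    intro f B hB
    refine ⟨fun v w => ?_, fun v => ?_, fun u v w => ?_⟩
    · rw [← hB v w zeroVec, ← hB w v zeroVec, iw_bxor_assoc, iw_bxor_assoc, bxor_comm v w]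
      cases f zeroVec <;> cases f (bxor zeroVec w) <;> cases f (bxor zeroVec v) <;> cases f (bxor zeroVec (bxor w v)) <;> rfl
    · rw [← hB v v zeroVec, iw_bxor_assoc, bxor_self, bxor_zeroVec]
      cases f zeroVec <;> cases f (bxor zeroVec v) <;> rfl
    · rw [← hB (bxor u v) w zeroVec, ← hB u w zeroVec, ← hB v w u]
      simp only [zeroVec_bxor]
      cases f zeroVec <;> cases f w <;> cases f u <;> cases f (bxor u w) <;> cases f (bxor u v) <;>
        cases f (bxor (bxor u v) w) <;> rfl
  obtain ⟨hsymm₀, halt₀, hadd₀⟩ := hsa f₀ B₀ hB₀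
  obtain ⟨hsymm₁, halt₁, hadd₁⟩ := hsa f₁ B₁ hB₁
  obtain ⟨h₀, b₀, c₀, h01, h02, h03, h04, hmax₀⟩ := tcs_frame_exists B₀ hsymm₀ halt₀
  obtain ⟨h₁, b₁, c₁, h11, h12, h13, h14, hmax₁⟩ := tcs_frame_exists B₁ hsymm₁ halt₁
  have hsub := tce_rank_subadd B₀ B₁ hsymm₀ hadd₀ hsymm₁ hadd₁ h₀ b₀ c₀ h01 h02 h03 hmax₀ h₁ b₁ c₁ h11 h12 h13 hmax₁
    μ bω cω hω1 hω2 hω3 hωmax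
  obtain ⟨hle₀, -⟩ := tce_radical_card B₀ hsymm₀ hadd₀ h₀ b₀ c₀ h01 h02 h03 hmax₀
  obtain ⟨hle₁, -⟩ := tce_radical_card B₁ hsymm₁ hadd₁ h₁ b₁ c₁ h11 h12 h13 hmax₁
  obtain ⟨-, hD₀⟩ := tce_dickson_exact f₀ B₀ hB₀ h₀ b₀ c₀ h01 h02 h03 hmax₀
  obtain ⟨-, hD₁⟩ := tce_dickson_exact f₁ B₁ hB₁ h₁ b₁ c₁ h11 h12 h13 hmax₁
  exact ⟨h₀, h₁, b₀, c₀, b₁, c₁, ⟨h01, h02, h03, h04, hmax₀⟩, ⟨h11, h12, h13, h14, hmax₁⟩, hsub, hle₀, hle₁, hD₀, hD₁⟩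

/-- **Cell lemma L2 on 8 bits** (E1280-HANDPROOFS App. A.4): two quadratics `f₀, f₁` on `𝔽₂⁸` whose forms differ by a form `ω` of
rank `2μ ≥ 6` and with `#f₀ + #f₁ < 160` have `B₀ ≡ 0` or `B₁ ≡ 0` (i.e. the common alternating part is `0` or `ω`).
[this work; cite: MacWilliamsSloane1977, Ch. 15 §2] -/
theorem tcl_halves_eight (f₀ f₁ : (Fin 8 → Bool) → Bool) (B₀ B₁ : (Fin 8 → Bool) → (Fin 8 → Bool) → Bool)
    (hB₀ : ∀ v w x, ((f₀ x ^^ f₀ (bxor x w)) ^^ (f₀ (bxor x v) ^^ f₀ (bxor (bxor x v) w))) = B₀ v w)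
    (hB₁ : ∀ v w x, ((f₁ x ^^ f₁ (bxor x w)) ^^ (f₁ (bxor x v) ^^ f₁ (bxor (bxor x v) w))) = B₁ v w)
    (μ : ℕ) (hμ : 3 ≤ μ) (bω cω : Fin μ → (Fin 8 → Bool))
    (hω1 : ∀ i, (B₀ (bω i) (cω i) ^^ B₁ (bω i) (cω i)) = true)
    (hω2 : ∀ i j, i ≠ j → (B₀ (bω i) (cω j) ^^ B₁ (bω i) (cω j)) = false)
    (hω3 : ∀ i j, (B₀ (bω i) (bω j) ^^ B₁ (bω i) (bω j)) = false)
    (hωmax : ∀ x y, (∀ i, (B₀ x (bω i) ^^ B₁ x (bω i)) = false) → (∀ i, (B₀ x (cω i) ^^ B₁ x (cω i)) = false) →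
      (∀ i, (B₀ y (bω i) ^^ B₁ y (bω i)) = false) → (∀ i, (B₀ y (cω i) ^^ B₁ y (cω i)) = false) → (B₀ x y ^^ B₁ x y) = false)
    (hlt : #(univ.filter fun x : Fin 8 → Bool => f₀ x = true) + #(univ.filter fun x : Fin 8 → Bool => f₁ x = true) < 160) :
    (∀ x y, B₀ x y = false) ∨ (∀ x y, B₁ x y = false) := by
  obtain ⟨h₀, h₁, b₀, c₀, b₁, c₁, ⟨-, -, -, -, hmax₀⟩, ⟨-, -, -, -, hmax₁⟩, hsub, hle₀, hle₁, hD₀, hD₁⟩ :=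
    tcl_halves_rank f₀ f₁ B₀ B₁ hB₀ hB₁ μ bω cω hω1 hω2 hω3 hωmax
  by_cases hz₀ : h₀ = 0
  · left
    subst hz₀
    exact fun x y => hmax₀ x y (fun i => Fin.elim0 i) (fun i => Fin.elim0 i) (fun i => Fin.elim0 i) (fun i => Fin.elim0 i)
  by_cases hz₁ : h₁ = 0
  · right
    subst hz₁
    exact fun x y => hmax₁ x y (fun i => Fin.elim0 i) (fun i => Fin.elim0 i) (fun i => Fin.elim0 i) (fun i => Fin.elim0 i)
  exfalso
  have hh₀ : h₀ ≤ 4 := by omega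
  have hh₁ : h₁ ≤ 4 := by omega
  interval_cases h₀ <;> interval_cases h₁ <;> simp only [Nat.reducePow, Nat.reduceSub] at hD₀ hD₁ <;> omega

end Summit.QuantumAdvantage.QuantumAdvantage.Theorems.CubicForrelation.NearExactIsExact
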